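import Summits.BirchSwinnertonDyer.BirchSwinnertonDyer.Theorems.SignedBaseChangeAnticyclotomicEisensteinDivisibilityEisensteinTransfer
import Literature.NumberTheory.EllipticCurves.CastellaGrossiSkinner2025.GreenbergAnticyclotomicMainConjectureProofs
import Summits.BirchSwinnertonDyer.BirchSwinnertonDyer.Theorems.SignedBaseChangeK2RDivisibilityDescent
import HarnessLib

/-!
# The CONVERSE Eisenstein-direction transfer (Castella–Wan, proof of Thm. 6.8 run backwards for the
# `⊆` divisibility): BDP side `⊆` ⟹ signed Heegner side `⊆`, PROVED on the tree's carriers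

Lead seat bsd-line-sbc-p1 (gen 13), `--supports stmt-BirchSwinnertonDyer-20727` (crux
`AnticyclotomicEisensteinDivisibility`, line `bdpline`). Castella–Wan's Thm. 6.8 (Math. Ann. 389 (2024), MS
pp. 29–31) asserts the EQUIVALENCE of the signed Heegner point main conjecture 4.8 (3) with the BDP main
conjecture 5.2, "and the same result holds for the opposite divisibilities". The tree holds (i)`⊇` ⟹ (ii)`⊇`
(`AcSigned.TransferInputs.mem_XAc_charIdeal_map_of_howard`) and (i)`⊆` ⟹ (ii)`⊆` up to `p^k`
(`SignedBaseChangeAcDivEisensteinTransfer.TransferInputs.span_pow_mul_charIdeal_le_span_sq`, p634573). THIS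
FILE proves **(ii)`⊆` ⟹ (i)`⊆` up to `p^k`** under exactly the hypotheses of the forward file
(`TransferInputs … ε z L`; `loc_𝔭` injective on `Sel_ε`; `X_ε` f.g. of rank one; `hEq` = print's
"`Sel_±(K, 𝐓^ac) = Sel_{±,rel}(K, 𝐓^ac)`"). So the registered research statement Form T
(`stub_signedEisensteinSS_mult`, signed-Heegner currency — the text the cell asks to PROMOTE) and the rational
BDP Eisenstein inclusion `(p^k)·char_Λ(X^{rel,str})·R₀⟦T⟧ ⊆ (L)` in Castella–Wan's own currency are
interchangeable targets modulo the line's named facts (the `iff` on `AcSelmer.XAc` is the sequel file).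

ARGUMENT. With `a = Log(loc_𝔭 z)`, `I = Log(loc_𝔭(Sel_ε))`, `c = char(ker r') = ι(char(Λ/I))`,
`h = ι(char(Sel_ε/Λz))`, `t = char(X_{ε,tors})`, the forward file's bookkeeping gives
`char(X^{rel,str}) = char(ker r)·c·t` ((6.15)–(6.16)), `char(ker r) = c` (`hEq`), `(ι a)² = h²·c²` and
`h·c = (ι a)` ((6.14)). The BDP-side input `(p^k)·char(X^{rel,str}) ⊆ ((ι a)²)` thus reads
`(p^k)·t·c·c ⊆ h²·c·c`; multiplying by `h` turns a factor `c` into the principal ideal `(ι a)`, `ι a ≠ 0`,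
which CANCELS in the domain `Λ` (`Ideal.span_singleton_mul_right_mono`) — twice: `(p^k)·t ⊆ h²`. The
`R₀⟦T⟧`-form descends to `Λ` by the explicit reciprocity law (field `signedLog_erl`) and the tree's
Weierstrass descent `iwasawaAlgebra_dvd_of_map_dvd_map_padicComplexInt` along `R₀ ⊆ 𝒪_{ℂ_p}`.

Contents (all PROVED, standard axioms; no definition, no named fact, no `sorry`): `Ideal.le_of_mul_le_mul_of_mul_eq_span`
(cancellation), `TransferInputs.span_pow_mul_torsionCharIdeal_le_of_le_span_sq` (THE CONVERSE TRANSFER in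
`Λ`; body = the forward file's §1 verbatim up to (6.14)–(6.16), then cancellation),
`iwasawaAlgebra_dvd_of_map_dvd_map_unr`, `TransferInputs.span_pow_mul_torsionCharIdeal_le_of_map_le_span`
(from the `R₀⟦T⟧`-form along ONE compatible `j`). Nothing about elliptic curves is asserted
unconditionally; BSD / the crux are NOT proved by this file.
-/
-- D-0017: single-problem summit, the namespace repeats the problem name by design.
set_option linter.dupNamespace false
set_option autoImplicit false

noncomputable section

open scoped Classical

open PowerSeries NumberField IsDedekindDomain Field
open Literature.NumberTheory.EllipticCurves Literature.NumberTheory.GaloisRepresentations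
open Literature.NumberTheory.EllipticCurves.IwasawaDual
open Literature.NumberTheory.EllipticCurves.AcSigned

universe u

namespace Summit.BirchSwinnertonDyer.BirchSwinnertonDyer.Theorems.SignedBaseChangeAcDivEisensteinTransferConverse

section Assembly

variable {K : Type u} [Field K] [NumberField K] {W : WeierstrassCurve K} {p : ℕ} [Fact p.Prime]
  {κ : ZpExtension K p} {γ : absoluteGaloisGroup K} {hγ : κ.IsTopGenerator γ}
  {𝔭 : HeightOneSpectrum (𝓞 K)} {h𝔭 : IsNonsplitIn κ 𝔭} {γ𝔭 : absoluteGaloisGroup (𝔭.adicCompletion K)}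
  {hγ𝔭 : κ (resGalOfEmb (closureEmb (K := K) (𝔭.adicCompletion K)) γ𝔭) = κ γ}
  {𝔭' : HeightOneSpectrum (𝓞 K)} {h𝔭𝔭' : 𝔭 ≠ 𝔭'} {h𝔭p : ((p : ℕ) : 𝓞 K) ∈ 𝔭.asIdeal} {ε : ℤˣ}
  {z : selmerLambdaAdic W p κ γ (fun _ ↦ .sgn ε)} {L : UnrSeries p}

/-! ## §1 The converse Eisenstein-direction transfer -/

/-- Cancellation of an ideal factor that becomes principal after one more multiplication: if
`D·C = (x)` with `x ≠ 0` in a domain, then `A·C ≤ B·C` implies `A ≤ B`. [folklore] -/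
theorem Ideal.le_of_mul_le_mul_of_mul_eq_span {R : Type*} [CommRing R] [IsDomain R]
    {A B C D : Ideal R} {x : R} (hx : x ≠ 0) (hDC : D * C = Ideal.span {x}) (h : A * C ≤ B * C) :
    A ≤ B := by
  have h1 : D * (A * C) ≤ D * (B * C) := Ideal.mul_mono_right h
  have e : ∀ E : Ideal R, D * (E * C) = Ideal.span {x} * E := fun E ↦ by
    rw [← hDC]; ring
  rw [e, e] at h1
  exact (Ideal.span_singleton_mul_right_mono hx).mp h1

set_option maxHeartbeats 4000000 in
set_option synthInstance.maxHeartbeats 200000 in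
/-- **The CONVERSE transfer for the `⊆` divisibility (Castella–Wan, proof of Thm. 6.8, (ii) with `⊆`
⟹ (i) with `⊆`, up to a power of `p`), PROVED on the tree's carriers for every prime `p`.**
Hypotheses: those of the forward transfer `SignedBaseChangeAcDivEisensteinTransfer.TransferInputs.
span_pow_mul_charIdeal_le_span_sq` (`TransferInputs … ε z L`; `loc_𝔭` injective on `Sel_ε(K, 𝐓^ac)`;
`X_ε` f.g. of rank one; `hEq` = print's "`Sel_±(K, 𝐓^ac) = Sel_{±,rel}(K, 𝐓^ac)`"), a signed logarithm
`Log`, and the BDP-SIDE INPUT `(p^k)·char_Λ(X^{rel,str}) ⊆ ((ι Log loc_𝔭 z)²)`. Conclusion: the signed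
Heegner-side Eisenstein inclusion `(p^k)·char_Λ(X_{ε,tors}) ⊆ ι(char_Λ(Sel_ε/Λ z))²` (`ι`-twisted form,
flag `dual-convention`). Proof: the forward file's §1 verbatim up to (6.14)–(6.16), then cancellation of
`char(ker r')²` against `ι(char(Sel_ε/Λz))·char(ker r') = (ι a)`, `ι a ≠ 0`.
[cite: CastellaWan2023, Thm. 6.8 "the same result holds for the opposite divisibilities" and its proof, (6.12)–(6.16) (MS pp. 29–31)] -/
theorem TransferInputs.span_pow_mul_torsionCharIdeal_le_of_le_span_sq [W.IsElliptic]
    (h : TransferInputs W p κ γ hγ 𝔭 h𝔭 γ𝔭 hγ𝔭 𝔭' h𝔭𝔭' h𝔭p ε z L)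
    (hinj : Function.Injective (locSignedAt W p κ 𝔭 h𝔭 γ γ𝔭 hγ𝔭 (fun _ ↦ .sgn ε) ε rfl h𝔭p))
    (hX : X.HasRank W p κ ∅ (fun _ ↦ .sgn ε) hγ 1)
    (hEq : ∀ x' : selmerLambdaAdic W p κ γ (PCond.at 𝔭' .rel (.sgn ε)),
      ∃ x : selmerLambdaAdic W p κ γ (fun _ ↦ .sgn ε),
        locSignedAt W p κ 𝔭 h𝔭 γ γ𝔭 hγ𝔭 (fun _ ↦ .sgn ε) ε rfl h𝔭p x =
          locSignedAt W p κ 𝔭 h𝔭 γ γ𝔭 hγ𝔭 (PCond.at 𝔭' .rel (.sgn ε)) ε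
            (PCond.at_of_ne .rel (.sgn ε) h𝔭𝔭') h𝔭p x')
    {k : ℕ}
    (Log : localSignedLambdaAdic (W.baseChange (𝔭.adicCompletion K)) p (localizeAt κ 𝔭 h𝔭) γ𝔭 ε →+
        IwasawaAlgebra p) (hLog : IsSignedLog W p κ γ hγ 𝔭 h𝔭 γ𝔭 hγ𝔭 ε Log)
    (hBDP : Ideal.span {((p : ℕ) : IwasawaAlgebra p) ^ k} * X.charIdeal W p κ ∅ (PCond.at 𝔭' .str .rel) hγ ≤
      Ideal.span
        {IwasawaAlgebra.invol p (Log (locSignedAt W p κ 𝔭 h𝔭 γ γ𝔭 hγ𝔭 (fun _ ↦ .sgn ε) ε rfl h𝔭p z)) ^ 2}) :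
    letI := selmerLambdaAdic.moduleOfGen W p κ γ hγ (fun _ ↦ PCond.sgn ε)
    Ideal.span {((p : ℕ) : IwasawaAlgebra p) ^ k} * X.torsionCharIdeal W p κ ∅ (fun _ ↦ .sgn ε) hγ ≤
      ((Module.charIdeal (IwasawaAlgebra p)
        (selmerLambdaAdic W p κ γ (fun _ ↦ .sgn ε) ⧸
          Submodule.span (IwasawaAlgebra p) {z})).map (IwasawaAlgebra.invol p)) ^ 2 := by
  -- the carriers and their module structures
  letI iS : Module (IwasawaAlgebra p) (selmerLambdaAdic W p κ γ (fun _ ↦ .sgn ε)) :=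
    selmerLambdaAdic.moduleOfGen W p κ γ hγ (fun _ ↦ PCond.sgn ε)
  letI iS' : Module (IwasawaAlgebra p) (selmerLambdaAdic W p κ γ (PCond.at 𝔭' .rel (.sgn ε))) :=
    selmerLambdaAdic.moduleOfGen W p κ γ hγ (PCond.at 𝔭' .rel (.sgn ε))
  letI iH : Module (IwasawaAlgebra p) (localSignedLambdaAdic (W.baseChange (𝔭.adicCompletion K)) p
      (localizeAt κ 𝔭 h𝔭) γ𝔭 ε) :=
    localSignedLambdaAdic.moduleOfGen (W.baseChange (𝔭.adicCompletion K)) p (localizeAt κ 𝔭 h𝔭)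
      γ𝔭 (isTopGenerator_localize_of_apply_eq p κ _ h𝔭 hγ𝔭 hγ) ε
  letI iXre : Module (IwasawaAlgebra p) (X W p κ ∅ (PCond.at 𝔭 .rel (.sgn ε))) :=
    X.moduleOfGen W p κ ∅ (PCond.at 𝔭 .rel (.sgn ε)) hγ
  letI iXe : Module (IwasawaAlgebra p) (X W p κ ∅ (fun _ ↦ .sgn ε)) :=
    X.moduleOfGen W p κ ∅ (fun _ ↦ .sgn ε) hγ
  letI iXrs : Module (IwasawaAlgebra p) (X W p κ ∅ (PCond.at 𝔭' .str .rel)) :=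
    X.moduleOfGen W p κ ∅ (PCond.at 𝔭' .str .rel) hγ
  letI iXes : Module (IwasawaAlgebra p) (X W p κ ∅ (PCond.at 𝔭' .str (.sgn ε))) :=
    X.moduleOfGen W p κ ∅ (PCond.at 𝔭' .str (.sgn ε)) hγ
  haveI : Module.Finite (IwasawaAlgebra p) (X W p κ ∅ (PCond.at 𝔭 .rel (.sgn ε))) :=
    X.module_finite_empty W p κ _ hγ
  haveI : Module.Finite (IwasawaAlgebra p) (X W p κ ∅ (fun _ ↦ .sgn ε)) :=
    X.module_finite_empty W p κ _ hγ
  haveI : Module.Finite (IwasawaAlgebra p) (X W p κ ∅ (PCond.at 𝔭' .str .rel)) :=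
    X.module_finite_empty W p κ _ hγ
  haveI : Module.Finite (IwasawaAlgebra p) (X W p κ ∅ (PCond.at 𝔭' .str (.sgn ε))) :=
    X.module_finite_empty W p κ _ hγ
  -- `Sel_ε ≤ Sel^{ε,rel}` and the two localisation maps agree on it
  have hle : selmerLambdaAdic W p κ γ (fun _ ↦ .sgn ε) ≤
      selmerLambdaAdic W p κ γ (PCond.at 𝔭' .rel (.sgn ε)) :=
    selmerLambdaAdic_sgn_le_at_rel W p κ γ 𝔭' ε
  have hloc'_incl : ∀ x : selmerLambdaAdic W p κ γ (fun _ ↦ .sgn ε),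
      locSignedAt W p κ 𝔭 h𝔭 γ γ𝔭 hγ𝔭 (PCond.at 𝔭' .rel (.sgn ε)) ε (PCond.at_of_ne .rel (.sgn ε) h𝔭𝔭') h𝔭p
          (AddSubgroup.inclusion hle x) =
        locSignedAt W p κ 𝔭 h𝔭 γ γ𝔭 hγ𝔭 (fun _ ↦ .sgn ε) ε rfl h𝔭p x := fun x ↦ Subtype.ext rfl
  -- `Λ`-linear packaging of `loc_𝔭` (on `Sel_ε`, `Sel^{ε,rel}`) and of `Log`
  have hloc_smul : ∀ (f : IwasawaAlgebra p) (x : selmerLambdaAdic W p κ γ (fun _ ↦ .sgn ε)),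
      locSignedAt W p κ 𝔭 h𝔭 γ γ𝔭 hγ𝔭 (fun _ ↦ .sgn ε) ε rfl h𝔭p (f • x) =
        f • locSignedAt W p κ 𝔭 h𝔭 γ γ𝔭 hγ𝔭 (fun _ ↦ .sgn ε) ε rfl h𝔭p x :=
    fun f x ↦ locSignedAt_smul W p κ 𝔭 h𝔭 hγ𝔭 hγ rfl h𝔭p f x
  have hloc'_smul : ∀ (f : IwasawaAlgebra p)
      (x : selmerLambdaAdic W p κ γ (PCond.at 𝔭' .rel (.sgn ε))),
      locSignedAt W p κ 𝔭 h𝔭 γ γ𝔭 hγ𝔭 (PCond.at 𝔭' .rel (.sgn ε)) ε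
          (PCond.at_of_ne .rel (.sgn ε) h𝔭𝔭') h𝔭p (f • x) =
        f • locSignedAt W p κ 𝔭 h𝔭 γ γ𝔭 hγ𝔭 (PCond.at 𝔭' .rel (.sgn ε)) ε
          (PCond.at_of_ne .rel (.sgn ε) h𝔭𝔭') h𝔭p x :=
    fun f x ↦ locSignedAt_smul W p κ 𝔭 h𝔭 hγ𝔭 hγ (PCond.at_of_ne .rel (.sgn ε) h𝔭𝔭') h𝔭p f x
  obtain ⟨Logₗ, hLogₗ⟩ : ∃ Logₗ : localSignedLambdaAdic (W.baseChange (𝔭.adicCompletion K)) p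
      (localizeAt κ 𝔭 h𝔭) γ𝔭 ε →ₗ[IwasawaAlgebra p] IwasawaAlgebra p, ∀ y, Logₗ y = Log y :=
    ⟨{ toFun := Log, map_add' := map_add Log, map_smul' := fun f y ↦ hLog.1 f y }, fun _ ↦ rfl⟩
  obtain ⟨locₗ, hlocₗ⟩ : ∃ locₗ : selmerLambdaAdic W p κ γ (fun _ ↦ .sgn ε) →ₗ[IwasawaAlgebra p]
      localSignedLambdaAdic (W.baseChange (𝔭.adicCompletion K)) p (localizeAt κ 𝔭 h𝔭) γ𝔭 ε,
      ∀ x, locₗ x = locSignedAt W p κ 𝔭 h𝔭 γ γ𝔭 hγ𝔭 (fun _ ↦ .sgn ε) ε rfl h𝔭p x :=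
    ⟨{ toFun := fun x ↦ locSignedAt W p κ 𝔭 h𝔭 γ γ𝔭 hγ𝔭 (fun _ ↦ .sgn ε) ε rfl h𝔭p x,
       map_add' := map_add _, map_smul' := fun f x ↦ hloc_smul f x }, fun _ ↦ rfl⟩
  obtain ⟨loc'ₗ, hloc'ₗ⟩ : ∃ loc'ₗ : selmerLambdaAdic W p κ γ (PCond.at 𝔭' .rel (.sgn ε))
      →ₗ[IwasawaAlgebra p]
      localSignedLambdaAdic (W.baseChange (𝔭.adicCompletion K)) p (localizeAt κ 𝔭 h𝔭) γ𝔭 ε,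
      ∀ x, loc'ₗ x = locSignedAt W p κ 𝔭 h𝔭 γ γ𝔭 hγ𝔭 (PCond.at 𝔭' .rel (.sgn ε)) ε
        (PCond.at_of_ne .rel (.sgn ε) h𝔭𝔭') h𝔭p x :=
    ⟨{ toFun := fun x ↦ locSignedAt W p κ 𝔭 h𝔭 γ γ𝔭 hγ𝔭 (PCond.at 𝔭' .rel (.sgn ε)) ε
          (PCond.at_of_ne .rel (.sgn ε) h𝔭𝔭') h𝔭p x,
       map_add' := map_add _, map_smul' := fun f x ↦ hloc'_smul f x }, fun _ ↦ rfl⟩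
  -- `ψ = Log ∘ loc_𝔭 : Sel_ε → Λ` and `ψ' = Log ∘ loc_𝔭 : Sel^{ε,rel} → Λ`
  obtain ⟨ψ, hψ⟩ : ∃ ψ : selmerLambdaAdic W p κ γ (fun _ ↦ .sgn ε) →ₗ[IwasawaAlgebra p]
      IwasawaAlgebra p, ∀ x, ψ x = Log (locSignedAt W p κ 𝔭 h𝔭 γ γ𝔭 hγ𝔭 (fun _ ↦ .sgn ε) ε rfl h𝔭p x) :=
    ⟨Logₗ ∘ₗ locₗ, fun x ↦ by rw [LinearMap.comp_apply, hlocₗ, hLogₗ]⟩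
  obtain ⟨ψ', hψ'⟩ : ∃ ψ' : selmerLambdaAdic W p κ γ (PCond.at 𝔭' .rel (.sgn ε)) →ₗ[IwasawaAlgebra p]
      IwasawaAlgebra p, ∀ x, ψ' x = Log (locSignedAt W p κ 𝔭 h𝔭 γ γ𝔭 hγ𝔭 (PCond.at 𝔭' .rel (.sgn ε)) ε
        (PCond.at_of_ne .rel (.sgn ε) h𝔭𝔭') h𝔭p x) :=
    ⟨Logₗ ∘ₗ loc'ₗ, fun x ↦ by rw [LinearMap.comp_apply, hloc'ₗ, hLogₗ]⟩
  have hψ_inj : Function.Injective ψ := by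
    intro x y hxy
    rw [hψ, hψ] at hxy
    exact hinj (hLog.2.1 hxy)
  have ha : ψ z ≠ 0 := by
    intro ha0
    rw [hψ] at ha0
    have h0 : locSignedAt W p κ 𝔭 h𝔭 γ γ𝔭 hγ𝔭 (fun _ ↦ .sgn ε) ε rfl h𝔭p z = 0 :=
      hLog.2.1 (by rw [map_zero]; exact ha0)
    exact h.ne_zero (hinj (by rw [map_zero]; exact h0))
  have hιa : IwasawaAlgebra.invol p (ψ z) ≠ 0 := fun h0 ↦
    ha (IwasawaAlgebra.invol_injective p (by rw [h0, map_zero]))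
  -- the ideals `I = Log(loc(Sel_ε))` and `I' = Log(loc(Sel^{ε,rel}))` COINCIDE (`hEq`)
  have haI : ψ z ∈ LinearMap.range ψ := ⟨z, rfl⟩
  have hII' : LinearMap.range ψ = LinearMap.range ψ' := by
    apply le_antisymm
    · rintro _ ⟨x, rfl⟩
      exact ⟨AddSubgroup.inclusion hle x, by rw [hψ', hψ, hloc'_incl]⟩
    · rintro _ ⟨x', rfl⟩
      obtain ⟨x, hx⟩ := hEq x'
      exact ⟨x, by rw [hψ, hψ', hx]⟩
  have haI' : ψ z ∈ LinearMap.range ψ' := hII' ▸ haI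
  -- (6.14): `char(Sel_ε/Λz) · char(Λ/I) = (a)`, `a = ψ z = Log(loc z)`
  have h614 : Module.charIdeal (IwasawaAlgebra p)
        (selmerLambdaAdic W p κ γ (fun _ ↦ .sgn ε) ⧸ Submodule.span (IwasawaAlgebra p) {z}) *
      Module.charIdeal (IwasawaAlgebra p) (IwasawaAlgebra p ⧸ LinearMap.range ψ) =
        Ideal.span {ψ z} :=
    charIdeal_quotient_span_mul_charIdeal_quotient_range ψ hψ_inj z ha
  -- the twisted cokernels as quotients of `Λ`
  obtain ⟨δ', hδ'lin, hδ'ker, hδ'im⟩ := h.exact613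
  obtain ⟨δ, hδlin, hδker, hδim⟩ := h.exact612
  obtain ⟨Φ', hΦ'im, hΦ'ker⟩ := exists_linearMap_range_eq_ker_eq_of_semilinear
    (fun x ↦ locSignedAt W p κ 𝔭 h𝔭 γ γ𝔭 hγ𝔭 (fun _ ↦ .sgn ε) ε rfl h𝔭p x) Log hLog.1 hLog.2 δ'
    hδ'lin hδ'ker (LinearMap.range ψ) (fun f ↦ by
      rw [LinearMap.mem_range]
      exact exists_congr fun x ↦ by rw [hψ])
  obtain ⟨Φ, hΦim, hΦker⟩ := exists_linearMap_range_eq_ker_eq_of_semilinear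
    (fun x ↦ locSignedAt W p κ 𝔭 h𝔭 γ γ𝔭 hγ𝔭 (PCond.at 𝔭' .rel (.sgn ε)) ε
      (PCond.at_of_ne .rel (.sgn ε) h𝔭𝔭') h𝔭p x) Log hLog.1 hLog.2 δ
    hδlin hδker (LinearMap.range ψ') (fun f ↦ by
      rw [LinearMap.mem_range]
      exact exists_congr fun x ↦ by rw [hψ'])
  -- the restriction maps `r' : X^{rel,ε} ↠ X_ε`, `r : X^{rel,str} ↠ X^{ε,str}` and their kernels
  obtain ⟨r', hr'_apply, hr'_surj⟩ := X.exists_restrict_linearMap W p κ hγ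
    (selmer_sgn_le_at_rel W p κ ∅ 𝔭 ε)
  obtain ⟨r, hr_apply, hr_surj⟩ := X.exists_restrict_linearMap W p κ hγ
    (selmer_at_le_rel_away W p κ ∅ (𝔮 := 𝔭') .str (.sgn ε))
  have hker_r' : LinearMap.ker r' = LinearMap.range Φ' := by
    ext x'
    rw [LinearMap.mem_ker, hr'_apply, ← hδ'im x', LinearMap.mem_range]
    exact (hΦ'im x').symm
  have hker_r : LinearMap.ker r = LinearMap.range Φ := by
    ext x'
    rw [LinearMap.mem_ker, hr_apply, ← hδim x', LinearMap.mem_range]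
    exact (hΦim x').symm
  -- both kernels are killed by `ι(a) ≠ 0`
  have hY'tors : ∀ x ∈ LinearMap.ker r', IwasawaAlgebra.invol p (ψ z) • x = 0 := by
    intro x hx
    rw [hker_r', LinearMap.mem_range] at hx
    obtain ⟨f, rfl⟩ := hx
    have h0 : Φ' (IwasawaAlgebra.invol p (ψ z)) = 0 := by
      rw [← LinearMap.mem_ker, hΦ'ker]
      exact Ideal.mem_map_of_mem _ haI
    rw [← map_smul, smul_eq_mul, mul_comm, ← smul_eq_mul, map_smul, h0, smul_zero]
  have hYtors : ∀ x ∈ LinearMap.ker r, IwasawaAlgebra.invol p (ψ z) • x = 0 := by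
    intro x hx
    rw [hker_r, LinearMap.mem_range] at hx
    obtain ⟨f, rfl⟩ := hx
    have h0 : Φ (IwasawaAlgebra.invol p (ψ z)) = 0 := by
      rw [← LinearMap.mem_ker, hΦker]
      exact Ideal.mem_map_of_mem _ haI'
    rw [← map_smul, smul_eq_mul, mul_comm, ← smul_eq_mul, map_smul, h0, smul_zero]
  -- the abstract chain (6.15)–(6.16): `char(X^{rel,str}) = char(ker r)·char(ker r')·char(X_{ε,tors})`
  obtain ⟨-, -, -, h616⟩ :=
    Module.isTorsion_and_charIdeal_eq_of_surjective_pair r' hr'_surj r hr_surj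
      (IwasawaAlgebra.invol p (ψ z)) hιa hY'tors hYtors hX.2 h.lemma67.1 h.lemma67.2
  -- the kernels: `char(ker r') = ι(char(Λ/I)) = char(ker r)` (`I = I'`)
  have eY' : LinearMap.ker r' ≃ₗ[IwasawaAlgebra p]
      (IwasawaAlgebra p ⧸ Ideal.map (IwasawaAlgebra.invol p) (LinearMap.range ψ)) :=
    (LinearEquiv.ofEq _ _ hker_r').trans
      (Φ'.quotKerEquivRange.symm.trans (Submodule.quotEquivOfEq _ _ hΦ'ker))
  have eY : LinearMap.ker r ≃ₗ[IwasawaAlgebra p]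
      (IwasawaAlgebra p ⧸ Ideal.map (IwasawaAlgebra.invol p) (LinearMap.range ψ)) :=
    (LinearEquiv.ofEq _ _ hker_r).trans
      (Φ.quotKerEquivRange.symm.trans (Submodule.quotEquivOfEq _ _ (hII' ▸ hΦker)))
  have hY'char : Module.charIdeal (IwasawaAlgebra p) (LinearMap.ker r') =
      (Module.charIdeal (IwasawaAlgebra p) (IwasawaAlgebra p ⧸ LinearMap.range ψ)).map
        (IwasawaAlgebra.invol p) := by
    rw [Module.charIdeal_eq_of_linearEquiv eY', charIdeal_quotient_map_invol]
  have hYchar : Module.charIdeal (IwasawaAlgebra p) (LinearMap.ker r) =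
      Module.charIdeal (IwasawaAlgebra p) (LinearMap.ker r') := by
    rw [Module.charIdeal_eq_of_linearEquiv eY', Module.charIdeal_eq_of_linearEquiv eY]
  -- `(ι a)² = ι(char(Sel_ε/Λz))² · char(ker r')²`
  have hιa_span : Ideal.span {IwasawaAlgebra.invol p (ψ z) ^ 2} =
      ((Module.charIdeal (IwasawaAlgebra p)
          (selmerLambdaAdic W p κ γ (fun _ ↦ .sgn ε) ⧸ Submodule.span (IwasawaAlgebra p) {z})).map
          (IwasawaAlgebra.invol p)) ^ 2 *
        (Module.charIdeal (IwasawaAlgebra p) (LinearMap.ker r')) ^ 2 := by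
    rw [hY'char, ← mul_pow, ← map_invol_mul, h614, map_invol_span_singleton, Ideal.span_singleton_pow]

  -- (6.14) twisted: `ι(char(Sel_ε/Λz)) · char(ker r') = (ι a)`
  have h614ι : (Module.charIdeal (IwasawaAlgebra p)
          (selmerLambdaAdic W p κ γ (fun _ ↦ .sgn ε) ⧸ Submodule.span (IwasawaAlgebra p) {z})).map
          (IwasawaAlgebra.invol p) *
        Module.charIdeal (IwasawaAlgebra p) (LinearMap.ker r') =
      Ideal.span {IwasawaAlgebra.invol p (ψ z)} := by
    rw [hY'char, ← map_invol_mul, h614, map_invol_span_singleton]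
  -- the BDP-side input, rewritten: `(p^k)·t·c·c ≤ h·h·c·c`
  have hψz : ψ z = Log (locSignedAt W p κ 𝔭 h𝔭 γ γ𝔭 hγ𝔭 (fun _ ↦ .sgn ε) ε rfl h𝔭p z) := hψ z
  have hmain : (Ideal.span {((p : ℕ) : IwasawaAlgebra p) ^ k} *
          X.torsionCharIdeal W p κ ∅ (fun _ ↦ .sgn ε) hγ) *
        Module.charIdeal (IwasawaAlgebra p) (LinearMap.ker r') *
        Module.charIdeal (IwasawaAlgebra p) (LinearMap.ker r') ≤
      ((Module.charIdeal (IwasawaAlgebra p)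
          (selmerLambdaAdic W p κ γ (fun _ ↦ .sgn ε) ⧸ Submodule.span (IwasawaAlgebra p) {z})).map
          (IwasawaAlgebra.invol p)) ^ 2 *
        Module.charIdeal (IwasawaAlgebra p) (LinearMap.ker r') *
        Module.charIdeal (IwasawaAlgebra p) (LinearMap.ker r') := by
    have hB : Ideal.span {((p : ℕ) : IwasawaAlgebra p) ^ k} *
          Module.charIdeal (IwasawaAlgebra p) (X W p κ ∅ (PCond.at 𝔭' .str .rel)) ≤
        Ideal.span {IwasawaAlgebra.invol p (ψ z) ^ 2} := by
      rw [hψz]; exact hBDP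
    rw [hιa_span, h616, hYchar] at hB
    calc (Ideal.span {((p : ℕ) : IwasawaAlgebra p) ^ k} *
            X.torsionCharIdeal W p κ ∅ (fun _ ↦ .sgn ε) hγ) *
          Module.charIdeal (IwasawaAlgebra p) (LinearMap.ker r') *
          Module.charIdeal (IwasawaAlgebra p) (LinearMap.ker r')
        = Ideal.span {((p : ℕ) : IwasawaAlgebra p) ^ k} *
          (Module.charIdeal (IwasawaAlgebra p) (LinearMap.ker r') *
            (Module.charIdeal (IwasawaAlgebra p) (LinearMap.ker r') *
              Module.charIdeal (IwasawaAlgebra p)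
                (Submodule.torsion (IwasawaAlgebra p) (X W p κ ∅ (fun _ ↦ .sgn ε))))) := by
          change _ * Module.charIdeal (IwasawaAlgebra p)
            (Submodule.torsion (IwasawaAlgebra p) (X W p κ ∅ (fun _ ↦ .sgn ε))) * _ * _ = _
          ring
      _ ≤ ((Module.charIdeal (IwasawaAlgebra p)
            (selmerLambdaAdic W p κ γ (fun _ ↦ .sgn ε) ⧸ Submodule.span (IwasawaAlgebra p) {z})).map
            (IwasawaAlgebra.invol p)) ^ 2 *
          (Module.charIdeal (IwasawaAlgebra p) (LinearMap.ker r')) ^ 2 := hB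
      _ = _ := by ring
  -- cancel `char(ker r')` twice
  exact Ideal.le_of_mul_le_mul_of_mul_eq_span hιa h614ι
    (Ideal.le_of_mul_le_mul_of_mul_eq_span hιa h614ι hmain)

/-- **Divisibility in `Λ = ℤ_p⟦T⟧` is detected in `R₀⟦T⟧`** along a structure map `j : ℤ_p → R₀`
compatible with `ℤ_p ⊂ ℚ_p ⊂ ℂ_p` (push to `𝒪_{ℂ_p}⟦T⟧` along `R₀ ⊆ 𝒪_{ℂ_p}` and descend with the tree's
Weierstrass division `iwasawaAlgebra_dvd_of_map_dvd_map_padicComplexInt`).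
[cite: Washington1997, Prop. 7.2 and Thm. 7.3] [cite: Castella2018, §3 (R₀ ⊂ 𝒪_{ℂ_p}, arXiv:1704.06608 p. 9)] -/
theorem iwasawaAlgebra_dvd_of_map_dvd_map_unr {j : ℤ_[p] →+* unrIntegers p}
    (hj : ∀ x : ℤ_[p], ((j x : unrIntegers p) : ℂ_[p]) = algebraMap ℚ_[p] ℂ_[p] (x : ℚ_[p]))
    {a b : IwasawaAlgebra p} (hab : PowerSeries.map j a ∣ PowerSeries.map j b) : a ∣ b := by
  obtain ⟨J₀, hJ₀⟩ := exists_ringHom_unrIntegers_padicComplexInt (p := p)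
  have hJ : ∀ x : ℤ_[p], (((J₀.comp j) x : PadicComplexInt p) : ℂ_[p]) = ((x : ℚ_[p]) : ℂ_[p]) := by
    intro x
    rw [RingHom.comp_apply, hJ₀, hj]
    rfl
  refine SignedBaseChangeK2RDivisibilityDescent.iwasawaAlgebra_dvd_of_map_dvd_map_padicComplexInt hJ ?_
  rw [PowerSeries.map_comp, RingHom.comp_apply, RingHom.comp_apply]
  exact map_dvd (PowerSeries.map J₀) hab

set_option synthInstance.maxHeartbeats 200000 in
/-- **The converse transfer from the `R₀⟦T⟧`-form.** Under the hypotheses of the converse transfer, the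
BDP-side input may be given in Castella–Wan's (ii)-currency along ONE compatible structure map
`j : ℤ_p → R₀`: `(p^k)·char_Λ(X^{rel,str})·R₀⟦T⟧ ⊆ (L)`. The explicit reciprocity law of the inputs
(`(L) = ι((Log loc_𝔭 z)²)·R₀⟦T⟧`, field `signedLog_erl`) and descent of divisibility from `R₀⟦T⟧` to `Λ`
reduce it to the `Λ`-form. [cite: CastellaWan2023, Thm. 6.8 (ii) and its proof (MS pp. 30–31), Thm. 6.2 (MS p. 26)] -/
theorem TransferInputs.span_pow_mul_torsionCharIdeal_le_of_map_le_span [W.IsElliptic]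
    (h : TransferInputs W p κ γ hγ 𝔭 h𝔭 γ𝔭 hγ𝔭 𝔭' h𝔭𝔭' h𝔭p ε z L)
    (hinj : Function.Injective (locSignedAt W p κ 𝔭 h𝔭 γ γ𝔭 hγ𝔭 (fun _ ↦ .sgn ε) ε rfl h𝔭p))
    (hX : X.HasRank W p κ ∅ (fun _ ↦ .sgn ε) hγ 1)
    (hEq : ∀ x' : selmerLambdaAdic W p κ γ (PCond.at 𝔭' .rel (.sgn ε)),
      ∃ x : selmerLambdaAdic W p κ γ (fun _ ↦ .sgn ε),
        locSignedAt W p κ 𝔭 h𝔭 γ γ𝔭 hγ𝔭 (fun _ ↦ .sgn ε) ε rfl h𝔭p x =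
          locSignedAt W p κ 𝔭 h𝔭 γ γ𝔭 hγ𝔭 (PCond.at 𝔭' .rel (.sgn ε)) ε
            (PCond.at_of_ne .rel (.sgn ε) h𝔭𝔭') h𝔭p x')
    {k : ℕ} (j : ℤ_[p] →+* unrIntegers p)
    (hj : ∀ x : ℤ_[p], ((j x : unrIntegers p) : ℂ_[p]) = algebraMap ℚ_[p] ℂ_[p] (x : ℚ_[p]))
    (hBDP : Ideal.span {((p : ℕ) : UnrSeries p) ^ k} *
        (X.charIdeal W p κ ∅ (PCond.at 𝔭' .str .rel) hγ).map (PowerSeries.map j) ≤ Ideal.span {L}) :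
    letI := selmerLambdaAdic.moduleOfGen W p κ γ hγ (fun _ ↦ PCond.sgn ε)
    Ideal.span {((p : ℕ) : IwasawaAlgebra p) ^ k} * X.torsionCharIdeal W p κ ∅ (fun _ ↦ .sgn ε) hγ ≤
      ((Module.charIdeal (IwasawaAlgebra p)
        (selmerLambdaAdic W p κ γ (fun _ ↦ .sgn ε) ⧸
          Submodule.span (IwasawaAlgebra p) {z})).map (IwasawaAlgebra.invol p)) ^ 2 := by
  obtain ⟨Log, hLog, herl⟩ := h.signedLog_erl
  refine TransferInputs.span_pow_mul_torsionCharIdeal_le_of_le_span_sq h hinj hX hEq Log hLog ?_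
  rw [herl j hj, Ideal.map_span, Set.image_singleton, map_pow (IwasawaAlgebra.invol p)] at hBDP
  -- elementwise: `b ∣ p^k · x` for every `x ∈ char(X^{rel,str})`
  refine Ideal.mul_le.mpr fun r hr x hx ↦ ?_
  obtain ⟨r', rfl⟩ := Ideal.mem_span_singleton'.mp hr
  rw [mul_assoc]
  refine Ideal.mul_mem_left _ r' (Ideal.mem_span_singleton.mpr ?_)
  refine iwasawaAlgebra_dvd_of_map_dvd_map_unr hj (Ideal.mem_span_singleton.mp ?_)
  have hmem : ((p : ℕ) : UnrSeries p) ^ k * PowerSeries.map j x ∈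
      Ideal.span {((p : ℕ) : UnrSeries p) ^ k} *
        (X.charIdeal W p κ ∅ (PCond.at 𝔭' .str .rel) hγ).map (PowerSeries.map j) :=
    Ideal.mul_mem_mul (Ideal.mem_span_singleton_self _) (Ideal.mem_map_of_mem _ hx)
  have e : PowerSeries.map j (((p : ℕ) : IwasawaAlgebra p) ^ k * x) =
      ((p : ℕ) : UnrSeries p) ^ k * PowerSeries.map j x := by
    rw [map_mul, map_pow, map_natCast]
  rw [e]
  exact hBDP hmem

end Assembly

end Summit.BirchSwinnertonDyer.BirchSwinnertonDyer.Theorems.SignedBaseChangeAcDivEisensteinTransferConverse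

end
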